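import Literature.Probability.RandomPlanarGeometry.SAWCubicConnectiveConstantLower
import Literature.Probability.RandomPlanarGeometry.SAWQuarticConnectiveConstantLower
import Literature.Probability.RandomPlanarGeometry.SAWQuinticConnectiveConstantLower
import Literature.Probability.RandomPlanarGeometry.SAWQuinticConnectiveConstantLower8
import Literature.Probability.RandomPlanarGeometry.SAWQuarticConnectiveConstantLower10
import Literature.Probability.RandomPlanarGeometry.SAWCubicConnectiveConstantLower12
import Literature.Probability.RandomPlanarGeometry.SAWDimensionGap
import HarnessLib

/-!
# Certified lower bounds on `μ(ℤ^d)` in every dimension: `μ(ℤ^d) > d + 2.18` for `d ≥ 5`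

Topic `Literature/Probability/RandomPlanarGeometry` (a leaf joining four tree files by name): the kernel-certified
irreducible-bridge bounds `μ(ℤ³) > 4.24` (`Zd.connectiveConstant_three_gt_424_div_100`), `μ(ℤ⁴) > 5.87`
(`Zd.connectiveConstant_four_gt_587_div_100`), `μ(ℤ⁵) > 7.18` (`Zd.connectiveConstant_five_gt_718_div_100`) and the
unit dimension gap `μ(ℤ^d) + j ≤ μ(ℤ^{d+j})` (`Zd.connectiveConstant_add_nat_le`, Madras–Slade (1.1.1) / BDGS (1.13))
give `μ(ℤ^d) > d + 2.18` for all `d ≥ 5`, `> d + 1.87` for `d ≥ 4`, `> d + 1.24` for `d ≥ 3` — against the tree's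
generic floor `d + 1/2 ≤ μ(ℤ^d)` (`Zd.nat_add_half_le_connectiveConstant`, `SAWDimensionGapBounds.lean`). In print
`μ(ℤ^d) = 2d − 1 − 1/(2d) − 3/(2d)² − …` (Hara–Slade–Sokal 1993: `μ(ℤ⁶) = 10.874`, `μ(ℤ⁷) = 12.903`), so these are
honest but weak certified floors; the point is that ONE kernel method (irreducible-bridge certificate + Kesten's
inequality + the dimension gap) now bounds every `d`. (Lane «pcv-sawmu»; composition a-idea-2 g14, by name.)
Axioms: standard plus the `native_decide` count certificates of the three imported certificate files.
-/

namespace Literature.Probability.RandomPlanarGeometry.SAW.Zd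

/-- `μ(ℤ^{5+j}) > 7.18 + j`. [cite: HaraSladeSokal1993, Table 1 (p. 3) and Table 2 (p. 12)] [cite: BDGS2012, §1.3, eq. (1.13)] -/
theorem connectiveConstant_five_add_gt (j : ℕ) : (359 : ℝ) / 50 + j < connectiveConstant (5 + j) := by
  have h1 := connectiveConstant_five_gt_718_div_100
  have h2 := connectiveConstant_add_nat_le 5 j
  linarith

/-- `μ(ℤ^{4+j}) > 5.87 + j`. [cite: HaraSladeSokal1993, Table 1 (p. 3) and Table 2 (p. 12)] [cite: BDGS2012, §1.3, eq. (1.13)] -/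
theorem connectiveConstant_four_add_gt (j : ℕ) : (587 : ℝ) / 100 + j < connectiveConstant (4 + j) := by
  have h1 := connectiveConstant_four_gt_587_div_100
  have h2 := connectiveConstant_add_nat_le 4 j
  linarith

/-- `μ(ℤ^{3+j}) > 4.24 + j`. [cite: HaraSladeSokal1993, Table 1 (p. 3) and Table 2 (p. 12)] [cite: BDGS2012, §1.3, eq. (1.13)] -/
theorem connectiveConstant_three_add_gt (j : ℕ) : (106 : ℝ) / 25 + j < connectiveConstant (3 + j) := by
  have h1 := connectiveConstant_three_gt_424_div_100
  have h2 := connectiveConstant_add_nat_le 3 j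
  linarith

/-- **`μ(ℤ^d) > d + 2.18` for every `d ≥ 5`.** [cite: HaraSladeSokal1993, Table 1 (p. 3) and Table 2 (p. 12)]
[cite: BDGS2012, §1.3, eq. (1.13)] -/
theorem connectiveConstant_gt_nat_add_of_five_le (d : ℕ) (hd : 5 ≤ d) : (d : ℝ) + 109 / 50 < connectiveConstant d := by
  obtain ⟨j, rfl⟩ := Nat.exists_eq_add_of_le hd
  have h := connectiveConstant_five_add_gt j
  push_cast
  linarith

/-- **`μ(ℤ^d) > d + 1.87` for every `d ≥ 4`.** [cite: HaraSladeSokal1993, Table 1 (p. 3) and Table 2 (p. 12)]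
[cite: BDGS2012, §1.3, eq. (1.13)] -/
theorem connectiveConstant_gt_nat_add_of_four_le (d : ℕ) (hd : 4 ≤ d) : (d : ℝ) + 187 / 100 < connectiveConstant d := by
  obtain ⟨j, rfl⟩ := Nat.exists_eq_add_of_le hd
  have h := connectiveConstant_four_add_gt j
  push_cast
  linarith

/-- **`μ(ℤ^d) > d + 1.24` for every `d ≥ 3`.** [cite: HaraSladeSokal1993, Table 1 (p. 3) and Table 2 (p. 12)]
[cite: BDGS2012, §1.3, eq. (1.13)] -/
theorem connectiveConstant_gt_nat_add_of_three_le (d : ℕ) (hd : 3 ≤ d) : (d : ℝ) + 31 / 25 < connectiveConstant d := by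
  obtain ⟨j, rfl⟩ := Nat.exists_eq_add_of_le hd
  have h := connectiveConstant_three_add_gt j
  push_cast
  linarith

/-- For instance `μ(ℤ⁶) > 8.18` (Hara–Slade–Sokal: `10.874038`). [cite: HaraSladeSokal1993, Table 1 (p. 3) and Table 2 (p. 12)] -/
theorem connectiveConstant_six_gt_409_div_50 : (409 : ℝ) / 50 < connectiveConstant 6 := by
  have h := connectiveConstant_gt_nat_add_of_five_le 6 (by norm_num)
  push_cast at h
  linarith

end Literature.Probability.RandomPlanarGeometry.SAW.Zd

/-! ### Second edition of the floors (rungs `n = 8` for `ℤ⁵`, `n = 10` for `ℤ⁴`, `n = 12` for `ℤ³`) -/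

namespace Literature.Probability.RandomPlanarGeometry.SAW.Zd

/-- `μ(ℤ^{5+j}) > 7.38 + j`. [cite: HaraSladeSokal1993, Table 1 (p. 3) and Table 2 (p. 12)] [cite: BDGS2012, §1.3, eq. (1.13)] -/
theorem connectiveConstant_five_add_gt' (j : ℕ) : (369 : ℝ) / 50 + j < connectiveConstant (5 + j) := by
  have h1 := connectiveConstant_five_gt_738_div_100
  have h2 := connectiveConstant_add_nat_le 5 j
  linarith

/-- `μ(ℤ^{4+j}) > 5.94 + j`. [cite: HaraSladeSokal1993, Table 1 (p. 3) and Table 2 (p. 12)] [cite: BDGS2012, §1.3, eq. (1.13)] -/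
theorem connectiveConstant_four_add_gt' (j : ℕ) : (297 : ℝ) / 50 + j < connectiveConstant (4 + j) := by
  have h1 := connectiveConstant_four_gt_297_div_50
  have h2 := connectiveConstant_add_nat_le 4 j
  linarith

/-- `μ(ℤ^{3+j}) > 4.27 + j`. [cite: HaraSladeSokal1993, Table 1 (p. 3) and Table 2 (p. 12)] [cite: BDGS2012, §1.3, eq. (1.13)] -/
theorem connectiveConstant_three_add_gt' (j : ℕ) : (427 : ℝ) / 100 + j < connectiveConstant (3 + j) := by
  have h1 := connectiveConstant_three_gt_427_div_100
  have h2 := connectiveConstant_add_nat_le 3 j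
  linarith

/-- **`μ(ℤ^d) > d + 2.38` for every `d ≥ 5`.** [cite: HaraSladeSokal1993, Table 1 (p. 3) and Table 2 (p. 12)]
[cite: BDGS2012, §1.3, eq. (1.13)] -/
theorem connectiveConstant_gt_nat_add_of_five_le' (d : ℕ) (hd : 5 ≤ d) : (d : ℝ) + 119 / 50 < connectiveConstant d := by
  obtain ⟨j, rfl⟩ := Nat.exists_eq_add_of_le hd
  have h := connectiveConstant_five_add_gt' j
  push_cast
  linarith

/-- **`μ(ℤ^d) > d + 1.94` for every `d ≥ 4`.** [cite: HaraSladeSokal1993, Table 1 (p. 3) and Table 2 (p. 12)]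
[cite: BDGS2012, §1.3, eq. (1.13)] -/
theorem connectiveConstant_gt_nat_add_of_four_le' (d : ℕ) (hd : 4 ≤ d) : (d : ℝ) + 97 / 50 < connectiveConstant d := by
  obtain ⟨j, rfl⟩ := Nat.exists_eq_add_of_le hd
  have h := connectiveConstant_four_add_gt' j
  push_cast
  linarith

/-- **`μ(ℤ^d) > d + 1.27` for every `d ≥ 3`.** [cite: HaraSladeSokal1993, Table 1 (p. 3) and Table 2 (p. 12)]
[cite: BDGS2012, §1.3, eq. (1.13)] -/
theorem connectiveConstant_gt_nat_add_of_three_le' (d : ℕ) (hd : 3 ≤ d) : (d : ℝ) + 127 / 100 < connectiveConstant d := by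
  obtain ⟨j, rfl⟩ := Nat.exists_eq_add_of_le hd
  have h := connectiveConstant_three_add_gt' j
  push_cast
  linarith

/-- For instance `μ(ℤ⁶) > 8.38` (Hara–Slade–Sokal: `10.874038`). [cite: HaraSladeSokal1993, Table 1 (p. 3) and Table 2 (p. 12)] -/
theorem connectiveConstant_six_gt_419_div_50 : (419 : ℝ) / 50 < connectiveConstant 6 := by
  have h := connectiveConstant_gt_nat_add_of_five_le' 6 (by norm_num)
  push_cast at h
  linarith

end Literature.Probability.RandomPlanarGeometry.SAW.Zd
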